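import Summits.BirchSwinnertonDyer.BirchSwinnertonDyer.Theorems.ByReductionTypeAtTwoOrdKatoHalfAtTwoIsoRelaxedGenuineDefs
import Summits.BirchSwinnertonDyer.BirchSwinnertonDyer.Theorems.ByReductionTypeAtTwoAdditiveKatoFineConjAAbelianTwoDivision
import HarnessLib

/-!
# Route ByReductionTypeAtTwo, crux `OrdKatoHalfAtTwoIso` (stmt-BirchSwinnertonDyer-19573), child B7′ (stmt-BirchSwinnertonDyer-23921
# `OrdKatoMuPartOptimalAtTwo`): the RELAXED-GENUINE road at the lattice-optimal member — text R-opt, relaxed (A₂) for `ρ̄₂` NOT onto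
# from Ferrero–Washington + Lim@2 upstairs (kernel), B7′ and the crux BY NAME with NO half class (one definition + theorems)

Seat `cruxlead-stmt-BirchSwinnertonDyer-19573-w2` GEN 5 (prover WIDTH under the LEAD lineage `cruxlead-19573`; HOME
`run/shared/lean/pub/bsd-2adic/`; pen RC-406 (2) (d) «…on BOTH 0 < Δ cells (P⁺ and Col½-opt) WITHOUT naming a half class»). Sequel of
`…RelaxedGenuineDefs` (R⁺, Aʳ, the restriction `X^{rel} ↠ X`). HONEST FRAMING (cell bsd-2adic): BSD is not proved by any of this;
neither B7′ nor the crux is proved here. ONE DEFINITION of an OPEN statement displayed BY NAME (`@[conjecture]`, R-B77; NOT a Literature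
fact, nothing asserted) + theorems; every door is CONDITIONAL on displayed OPEN statements.

THE OBJECT. GEN 4 priced B7′ as PRINT {Abbes–Ullmo, modularity, Lim@2, Ferrero–Washington} + ONE memo binder Col½-opt =
`HasColemanHalfClassPackageAtTwo` at the lattice-optimal member, whose `0 < Δ` instances read HALF classes (F-27a). R-opt below replaces
it by Kato's GENUINE classes on relaxed-at-`∞` carriers, SIGN-UNIFORM: the genuine image clause is booked at `c_∞·L₂^{tree}` with
`c_∞ = 2^e`, `e = 1` if `0 < Δ_{W₀}` (rectangular) and `e = 0` if `Δ_{W₀} < 0` (rhombic; F-27a: Kato's class of `γ₁^∨` is booked exactly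
at the tree value), and the archimedean clause is Aʳ for `0 < Δ` and empty for `Δ < 0`. The relaxed (A₂) that the relaxed `μ`-door
needs is KERNEL modulo print on the whole not-onto locus (§2): `ℚ(W[2], i)` is abelian, so Ferrero–Washington + Lim 2017 Thm 3.5 at `2`
UPSTAIRS (named fact) + cell bsd-f1-sign2's descent give `ℓ₍₂₎(X₀^{rel ∞}(W/ℚ_∞)) = 0` — MEMO-7 Thm D (i) in the kernel modulo print.

* §1 `katoMuPartAtTwo_of_relaxedColeman_of_integralRatio` — `X5.O1.KatoMuPartAtTwo W′` at ONE curve, ANY image, from the relaxed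
  data (`∃`-Type) + relaxed (A₂) + «`0 ≤ ord₂ ϖ`» (the slack door of p703778).
* §2 `lengthAt_fineRelaxed_eq_zero_of_not_hasSurjectiveModNGaloisRep_of_limUpstairs_of_FW` — RELAXED (A₂) at every curve with
  `ρ̄₂` not onto, from two named facts + kernel descent.
* §3 TEXT R-opt `RelaxedZetaColemanIotaOptimalAtTwo` (+ `Iff.rfl`).
* §4 `relaxedColemanData_of_package_of_arch` (sign-uniform relaxed data at one good-ordinary curve from a package + Aʳ),
  **`katoMuPartOff514_of_print_of_relaxedZetaOptimal_of_arch`** / `ordKatoMuPartOptimalAtTwo_…`: B7′ = child 23921 BY NAME ⟸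
  R-opt + Aʳ + PRINT {Abbes–Ullmo, modularity, Lim@2 upstairs, Ferrero–Washington} — no half class.
* §5 `ordKatoHalfAtTwoIso_of_negDisc_of_relaxedZeta_of_arch_of_lim_upstairs` — the CRUX BY NAME with all three Coleman inputs
  (F1μι⁻ · R⁺ · R-opt) in the GENUINE-zeta currency, + Aʳ + Iw⁺ + print (lead g5's split glue p695020).

References: [Kato2004Asterisque] Thm 12.6, 16.2, 16.6, 17.4, 17.5, Prop 17.11, §17.13; reserve [ASP] Thm 6.9; [GreenbergLNM1716] §4
Lemma 4.6, p. 170; [Lim2017FineSelmer] Thm 3.5, Lemma 3.2; [FerreroWashington1979]; [AbbesUllmo1996] Thm A; [EdixhovenManin1991] Prop 2;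
MEMO-7 Lemma 0, Thm D; tree p692385, p695020, p699886, p700838, p703778, p704497, `…AdditiveKatoFineConjAAbelianTwoDivision` (addL2x).
-/

set_option autoImplicit false
set_option linter.dupNamespace false

noncomputable section

open scoped Classical MatrixGroups ModularForm NumberField
open CongruenceSubgroup WeierstrassCurve Field IsDedekindDomain NumberField
open Literature.NumberTheory.GaloisRepresentations
open Literature.NumberTheory.GaloisCohomology
open Literature.NumberTheory.EllipticCurves Literature.NumberTheory.EllipticCurves.ModularForms
open Literature.NumberTheory.EllipticCurves.Kato2004
  Literature.NumberTheory.EllipticCurves.Kato2004.EulerSystemValues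
open Literature.NumberTheory.EllipticCurves.Rank1Residual
open Literature.NumberTheory.EllipticCurves.Greenberg1999
open Literature.NumberTheory.IwasawaTheory
open Summit.BirchSwinnertonDyer.BirchSwinnertonDyer.Theorems.Rank1ResidualX1Defs
  Summit.BirchSwinnertonDyer.BirchSwinnertonDyer.Rank1Residual
  Summit.BirchSwinnertonDyer.BirchSwinnertonDyer.Rank1Residual.CoreAssembly
open Summit.BirchSwinnertonDyer.Rank1Residual Summit.BirchSwinnertonDyer.Rank1Residual.X5
  Summit.BirchSwinnertonDyer.Rank1Residual.X1.MuLambda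
open Summit.BirchSwinnertonDyer.BirchSwinnertonDyer.Theorems.OrdKatoOptimalAtTwo
  Summit.BirchSwinnertonDyer.BirchSwinnertonDyer.Theorems.OrdKatoIntAtTwo
open Summit.BirchSwinnertonDyer.BirchSwinnertonDyer.Theses.ByReductionTypeAtTwo
open Summit.BirchSwinnertonDyer.BirchSwinnertonDyer.Theorems.AlignedTransportAtTwoFineRoad

namespace Summit.BirchSwinnertonDyer.BirchSwinnertonDyer.Theorems.SteinbergFibreAtTwo

/-! ## §1 Kato's `μ`-part at ONE curve, ANY image, from the relaxed data (Néron-ratio form) -/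

/-- **`X5.O1.KatoMuPartAtTwo W′` at ONE curve — ANY image of `ρ̄₂` — from the RELAXED data** for every newform of `W′`, all
cyclotomic data, every `D` and `Yr` (SOME relaxed module `Xr` with package, exponent `e`, GENUINE image clause at `2^e·G₁`, archimedean
clause), relaxed (A₂) «`ℓ₍₂₎(Yr.X) = 0`» and «`0 ≤ ord₂ ϖ`» for every newform/Néron ratio: `L₀ = ϖ₀·G`, `2^{μ(X)} ∣ 2^{μ(G)} ∣ G ∣ L₀`
(the relaxed slack door `mu_le_mu_of_relaxedColemanSemilinear_of_arch`). The any-image twin of `katoMuPartAtTwo_of_relaxedColeman_irr`.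
[cite: GreenbergLNM1716, §1 p. 60, p. 170 (shape)] [cite: Kato2004Asterisque, §17.13 (pp. 279–280)] [cite: MazurTateTeitelbaum1986Invent, §I.12] -/
theorem katoMuPartAtTwo_of_relaxedColeman_of_integralRatio (W' : WeierstrassCurve ℚ) [W'.IsElliptic] [W'.IsGloballyMinimal]
    (hR : ∀ {N : ℕ} [NeZero N] (f : CuspForm (Gamma0 N) 2) (κ : ZpExtension ℚ 2) (γ : absoluteGaloisGroup ℚ),
      κ.IsCyclotomic → κ.IsTopGenerator γ → IsCyclotomicVariable 2 γ → IsNewformOf W' f →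
      ∀ (D : W'.SelmerDualData κ γ) (Yr : W'.FineSelmerDualDataRelaxedInf κ γ),
        ∃ (Xr : Type) (_ : AddCommGroup Xr) (_ : Module (IwasawaAlgebra 2) Xr)
          (θ : IwasawaAlgebra 2 ≃+* IwasawaAlgebra 2) (P : Submodule (IwasawaAlgebra 2) (IwasawaAlgebra 2))
          (M : Submodule (IwasawaAlgebra 2) P)
          (τ : P →ₛₗ[(θ : IwasawaAlgebra 2 →+* IwasawaAlgebra 2)] Xr) (π : Xr →ₗ[IwasawaAlgebra 2] Yr.X) (e : ℕ),
          (∀ m ∈ M, τ m = 0) ∧ Function.Surjective π ∧ Function.Exact τ π ∧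
          Module.lengthAt (IwasawaAlgebra 2) D.X
              ⟨IwasawaAlgebra.augIdealP 2, IwasawaAlgebra.isPrime_augIdealP_holds 2⟩ + e ≤
            Module.lengthAt (IwasawaAlgebra 2) Xr ⟨IwasawaAlgebra.augIdealP 2, IwasawaAlgebra.isPrime_augIdealP_holds 2⟩ ∧
          ∀ G₁ : IwasawaAlgebra 2, iwasawaToPowerSeries 2 G₁ = padicLFunction f (unitRoot W' 2 : ℚ_[2]) →
            ∃ s : IwasawaAlgebra 2, s ∉ IwasawaAlgebra.augIdealP 2 ∧
              s * (PowerSeries.C (((2 : ℕ) : ℤ_[2]) ^ e) * G₁) ∈ Submodule.map P.subtype M)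
    (hAr : ∀ (κ : ZpExtension ℚ 2) (γ : absoluteGaloisGroup ℚ), κ.IsCyclotomic → κ.IsTopGenerator γ →
      ∀ Yr : W'.FineSelmerDualDataRelaxedInf κ γ,
        Module.lengthAt (IwasawaAlgebra 2) Yr.X ⟨IwasawaAlgebra.augIdealP 2, IwasawaAlgebra.isPrime_augIdealP_holds 2⟩ = 0)
    (hϖ : ∀ {N : ℕ} [NeZero N] (f : CuspForm (Gamma0 N) 2), IsNewformOf W' f →
      ∀ ϖ : ℚ, (ϖ : ℝ) * W'.realPeriodRat = plusPeriod f → 0 ≤ padicValRat 2 ϖ) :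
    O1.KatoMuPartAtTwo W' := by
  intro κ γ hκ hγ hγ' hord _ f hf ϖ hϖf D L₀ hL₀
  obtain ⟨Yr⟩ := W'.nonempty_fineSelmerDualDataRelaxedInf κ hγ
  obtain ⟨Xr, _, _, θ, P, M, τ, π, e, hτM, -, hπ, harch, himg⟩ := hR f κ γ hκ hγ hγ' hf D Yr
  -- `L₂(f, α) = ι G` (INT2-AUTO) and `L₀ = ϖ₀ · G`
  obtain ⟨G, hG⟩ := exists_iwasawaToPowerSeries_eq_padicLFunction_two_auto (W := W') (f := f) hord hf
  have hnorm : ‖((ϖ : ℚ) : ℚ_[2])‖ ≤ 1 := by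
    by_cases h0 : ϖ = 0
    · subst h0; simp
    have hϖQ : ((ϖ : ℚ) : ℚ_[2]) ≠ 0 := by exact_mod_cast h0
    rw [Padic.norm_eq_zpow_neg_valuation hϖQ, Padic.valuation_ratCast]
    exact zpow_le_one_of_nonpos₀ (by norm_num) (by linarith [hϖ f hf ϖ hϖf])
  let ϖ₀ : ℤ_[2] := ⟨((ϖ : ℚ) : ℚ_[2]), hnorm⟩
  have hL₀G : L₀ = (PowerSeries.C ϖ₀ : IwasawaAlgebra 2) * G := by
    apply iwasawaToPowerSeries_injective 2
    rw [hL₀, map_mul, hG, iwasawaToPowerSeries, PowerSeries.map_C]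
    rfl
  by_cases hG0 : G = 0
  · rw [hL₀G, hG0, mul_zero]; exact dvd_zero _
  have hμ : D.mu ≤ mu G :=
    mu_le_mu_of_relaxedColemanSemilinear_of_arch (D := D) hG0 θ P M τ π hτM hπ (himg G hG) harch (hAr κ γ hκ hγ Yr)
  calc (PowerSeries.C (((2 : ℕ) : ℤ_[2]) ^ D.mu) : IwasawaAlgebra 2)
      ∣ PowerSeries.C (((2 : ℕ) : ℤ_[2]) ^ mu G) := map_dvd _ (pow_dvd_pow _ hμ)
    _ ∣ G := C_pow_mu_dvd hG0
    _ ∣ L₀ := by rw [hL₀G]; exact dvd_mul_left _ _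

/-! ## §2 RELAXED (A₂) at every curve with `ρ̄₂` NOT onto: Ferrero–Washington + Lim 2017 Thm 3.5 at `2` UPSTAIRS + descent -/

/-- **Relaxed statement (A₂) — «`ℓ₍₂₎(X₀^{rel ∞}(W/ℚ_∞)) = 0`» — at EVERY elliptic `W/ℚ` with `ρ̄_{W,2}` NOT onto, from Ferrero–Washington
and Lim 2017 Thm. 3.5 at `2` UPSTAIRS (both named facts) + the kernel descent** (MEMO-7 Thm D (i), relaxed form, in the kernel modulo
print): `ℚ(W[2])` is abelian (`ρ̄₂` not onto), hence so is `F = ℚ(W[2], i)` (`isAbelianGalois_divisionField_two_sup_adjoin`), so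
Ferrero–Washington gives Iwasawa's `μ₂ = 0` for `F^{cyc}`; Lim@2 upstairs gives statement (A) for `W` over `F^{cyc} = ℚ(W[2], μ_{2^∞})`
(no real place), and cell bsd-f1-sign2's descent lands in the RELAXED group over `ℚ_∞`. [cite: FerreroWashington1979, Theorem]
[cite: Lim2017FineSelmer, §3 Thm. 3.5 and Lemma 3.2] [cite: CoatesSujatha2005, statement (A) (§3)] -/
theorem lengthAt_fineRelaxed_eq_zero_of_not_hasSurjectiveModNGaloisRep_of_limUpstairs_of_FW
    (hLim : Lim2017.thm35_at_two_upstairs_fineSelmer_twoTorsion_finite_of_classicalMuVanishes)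
    (hFW : ferreroWashington1979_classicalMuVanishes) (W : WeierstrassCurve ℚ) [W.IsElliptic]
    (hns : ¬ W.HasSurjectiveModNGaloisRep 2) {κ : ZpExtension ℚ 2} (hκ : κ.IsCyclotomic) {γ : absoluteGaloisGroup ℚ}
    (hγ : κ.IsTopGenerator γ) (Yr : W.FineSelmerDualDataRelaxedInf κ γ) :
    Module.lengthAt (IwasawaAlgebra 2) Yr.X ⟨IwasawaAlgebra.augIdealP 2, IwasawaAlgebra.isPrime_augIdealP_holds 2⟩ = 0 := by
  haveI : IsAbelianGalois ℚ (W.divisionField 2) := by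
    by_contra hab
    exact hns ((AddKatoTwo.not_isAbelianGalois_divisionField_two_iff_hasSurjectiveModNGaloisRep W).mp hab)
  obtain ⟨i, hi, -⟩ := AddKatoTwo.exists_sq_eq_neg_one_mem_divisionField_four W two_ne_zero
  haveI := AddKatoTwo.isAbelianGalois_divisionField_two_sup_adjoin W hi
  have hL := AddKatoTwo.divisionField_two_sup_adjoin_le_divisionField_four W hi
  haveI : FiniteDimensional ℚ ↥(W.divisionField 2 ⊔ IntermediateField.adjoin ℚ {i}) :=
    FiniteDimensional.of_injective (IntermediateField.inclusion hL).toLinearMap (IntermediateField.inclusion_injective hL)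
  haveI : NumberField ↥(W.divisionField 2 ⊔ IntermediateField.adjoin ℚ {i}) := NumberField.mk
  have hμ : ∀ κL : ZpExtension ↥(W.divisionField 2 ⊔ IntermediateField.adjoin ℚ {i}) 2,
      κL.IsCyclotomic → ClassicalMuVanishes κL := fun κL hκL ↦ hFW _ 2 κL hκL
  exact LimRelUpstairs.lengthAt_relaxed_eq_zero_of_upstairs_two W κ hκ hγ (hLim W i hi hμ) Yr

/-! ## §3 R-opt — the relaxed GENUINE zeta reading at the lattice-optimal member (DISPLAYED TEXT) -/

/-- [MEMO tier, OPEN — a reading, nothing asserted] **R-opt — Kato's GENUINE zeta classes in RELAXED-at-`∞` Coleman coordinates at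
`p = 2` at the LATTICE-OPTIMAL member of every non-CM good-ordinary class with `ρ̄₂` NOT onto, ι-keyed, sign-uniform.** For every
non-CM globally minimal `W`, good ordinary at `2`, `ρ̄_{W,2}` NOT onto, every isogenous lattice-optimal `W₀` (datum `D₀`, `Λ_{W₀} = c₀·Λ_f`),
every newform `f` of `W₀`, the cyclotomic `(κ, γ)`, every relaxed Selmer dual datum `Dr` and relaxed fine datum `Yr` of `W₀`: a pinned
`𝐇¹` `I`, `Z ⊆ 𝐇¹` inside the span of GENUINE classes, an ideal `P ⊆ Λ`, `ℓ : 𝐇¹ → P`, an `ι`-semilinear column map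
`τ : P →ₛₗ[ι] X^{rel}` killing `ℓ(Z)` with image `ker(X^{rel} ↠ X₀^{rel})`, and the GENUINE image clause booked at `c_∞·L₂^{tree}`:
`s·(2^e·G₁) ∈ ℓ(Z)` with `e = 1` if `0 < Δ_{W₀}` (rectangular lattice, F-27a) and `e = 0` if `Δ_{W₀} < 0` (rhombic: Kato's class of
`γ₁^∨` is booked exactly at the tree value). The body of F1μι⁻ / R⁺ at the optimal member with relaxed carriers. Witness at memo tier:
KATO'S OWN SYSTEM for `T₂W₀` (no half class; at the optimal member the Néron differential is good for Kato's lattice, MEMO-7 Lemma 0 /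
Thm D). NOT in print at `2`; NOT a Literature fact; nothing asserted.
[cite: Kato2004Asterisque, Thm. 12.6 (p. 222), Thm. 16.2, Thm. 16.6 (p. 271), 17.5, Prop. 17.11 (p. 277), §17.13 (pp. 279–280) (shape only; nothing asserted)] -/
@[conjecture] def RelaxedZetaColemanIotaOptimalAtTwo : Prop :=
  ∀ (W : WeierstrassCurve ℚ) [W.IsElliptic] [W.IsGloballyMinimal],
    ¬ W.HasCM → GoodOrd W 2 → ¬ W.HasSurjectiveModNGaloisRep 2 →
    ∀ (W₀ : WeierstrassCurve ℚ) [W₀.IsElliptic] [W₀.IsGloballyMinimal]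
      [ContinuousSMul ℤ_[2] (W₀.tateModule 2)] [Module.Free ℤ_[2] (W₀.tateModule 2)] [Module.Finite ℤ_[2] (W₀.tateModule 2)]
      {N₀ : ℕ} [NeZero N₀] (D₀ : ModularParametrizationData W₀ N₀), WeierstrassCurve.IsIsogenous W W₀ →
      (∀ z ∈ D₀.L.lattice, ∃ w ∈ periodLattice D₀.f, z = D₀.c * w) →
    ∀ {N : ℕ} [NeZero N] (f : CuspForm (Gamma0 N) 2) (κ : ZpExtension ℚ 2) (γ : absoluteGaloisGroup ℚ) (hκ : κ.IsCyclotomic),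
      κ.IsTopGenerator γ → IsCyclotomicVariable 2 γ → IsNewformOf W₀ f →
      ∀ (Dr : W₀.SelmerDualDataRelaxedInf κ γ) (Yr : W₀.FineSelmerDualDataRelaxedInf κ γ),
        ∃ (I : IwasawaH1Data W₀ 2 κ γ)
          (Z : Submodule (IwasawaAlgebra 2) I.H) (P : Submodule (IwasawaAlgebra 2) (IwasawaAlgebra 2))
          (ℓ : I.H →ₗ[IwasawaAlgebra 2] P)
          (τ : P →ₛₗ[((IwasawaAlgebra.involEquiv 2).toRingEquiv : IwasawaAlgebra 2 →+* IwasawaAlgebra 2)] Dr.X)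
          (π : Dr.X →ₗ[IwasawaAlgebra 2] Yr.X),
          Z ≤ Submodule.span (IwasawaAlgebra 2) {s : I.H | IsEulerSystemClassTwo W₀ hκ I s} ∧
          (∀ z ∈ Z, τ (ℓ z) = 0) ∧ Function.Surjective π ∧ Function.Exact τ π ∧
          ∀ G₁ : IwasawaAlgebra 2,
            iwasawaToPowerSeries 2 G₁ = padicLFunction f (unitRoot W₀ 2 : ℚ_[2]) →
              ∃ s : IwasawaAlgebra 2, s ∉ IwasawaAlgebra.augIdealP 2 ∧
                s * (PowerSeries.C (((2 : ℕ) : ℤ_[2]) ^ (if 0 < W₀.Δ then 1 else 0)) * G₁) ∈ Submodule.map (P.subtype ∘ₗ ℓ) Z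

/-- `RelaxedZetaColemanIotaOptimalAtTwo` unfolds to its displayed body. [folklore] -/
theorem relaxedZetaColemanIotaOptimalAtTwo_iff : RelaxedZetaColemanIotaOptimalAtTwo ↔
    ∀ (W : WeierstrassCurve ℚ) [W.IsElliptic] [W.IsGloballyMinimal],
    ¬ W.HasCM → GoodOrd W 2 → ¬ W.HasSurjectiveModNGaloisRep 2 →
    ∀ (W₀ : WeierstrassCurve ℚ) [W₀.IsElliptic] [W₀.IsGloballyMinimal]
      [ContinuousSMul ℤ_[2] (W₀.tateModule 2)] [Module.Free ℤ_[2] (W₀.tateModule 2)] [Module.Finite ℤ_[2] (W₀.tateModule 2)]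
      {N₀ : ℕ} [NeZero N₀] (D₀ : ModularParametrizationData W₀ N₀), WeierstrassCurve.IsIsogenous W W₀ →
      (∀ z ∈ D₀.L.lattice, ∃ w ∈ periodLattice D₀.f, z = D₀.c * w) →
    ∀ {N : ℕ} [NeZero N] (f : CuspForm (Gamma0 N) 2) (κ : ZpExtension ℚ 2) (γ : absoluteGaloisGroup ℚ) (hκ : κ.IsCyclotomic),
      κ.IsTopGenerator γ → IsCyclotomicVariable 2 γ → IsNewformOf W₀ f →
      ∀ (Dr : W₀.SelmerDualDataRelaxedInf κ γ) (Yr : W₀.FineSelmerDualDataRelaxedInf κ γ),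
        ∃ (I : IwasawaH1Data W₀ 2 κ γ)
          (Z : Submodule (IwasawaAlgebra 2) I.H) (P : Submodule (IwasawaAlgebra 2) (IwasawaAlgebra 2))
          (ℓ : I.H →ₗ[IwasawaAlgebra 2] P)
          (τ : P →ₛₗ[((IwasawaAlgebra.involEquiv 2).toRingEquiv : IwasawaAlgebra 2 →+* IwasawaAlgebra 2)] Dr.X)
          (π : Dr.X →ₗ[IwasawaAlgebra 2] Yr.X),
          Z ≤ Submodule.span (IwasawaAlgebra 2) {s : I.H | IsEulerSystemClassTwo W₀ hκ I s} ∧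
          (∀ z ∈ Z, τ (ℓ z) = 0) ∧ Function.Surjective π ∧ Function.Exact τ π ∧
          ∀ G₁ : IwasawaAlgebra 2,
            iwasawaToPowerSeries 2 G₁ = padicLFunction f (unitRoot W₀ 2 : ℚ_[2]) →
              ∃ s : IwasawaAlgebra 2, s ∉ IwasawaAlgebra.augIdealP 2 ∧
                s * (PowerSeries.C (((2 : ℕ) : ℤ_[2]) ^ (if 0 < W₀.Δ then 1 else 0)) * G₁) ∈ Submodule.map (P.subtype ∘ₗ ℓ) Z :=
  Iff.rfl

/-! ## §4 B7′ (child stmt-BirchSwinnertonDyer-23921) BY NAME from R-opt + Aʳ + FOUR PRINT facts — no half class -/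

/-- **The relaxed data of the door at ONE good-ordinary curve `V` from a relaxed zeta package into the CONSTRUCTED relaxed datum and
Aʳ**, sign-uniform: exponent `e = 1` with the archimedean `Λ/2 ↪ ker(X^{rel} ↠ X)` if `0 < Δ_V` (Aʳ), `e = 0` with the trivial
archimedean clause (`q` onto) if `Δ_V < 0`. [cite: GreenbergLNM1716, §4 Lemma 4.6 (PDF pp. 106–107)] -/
theorem relaxedColemanData_of_package_of_arch (hA : ArchimedeanLambdaModTwoOrdAtTwo)
    (V : WeierstrassCurve ℚ) [V.IsElliptic] [V.IsGloballyMinimal] (hord : IsOrdinaryAt V 2)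
    {N : ℕ} (f : CuspForm (Gamma0 N) 2) {κ : ZpExtension ℚ 2} {γ : absoluteGaloisGroup ℚ} (hκ : κ.IsCyclotomic)
    (hγ : κ.IsTopGenerator γ) (D : V.SelmerDualData κ γ) (Yr : V.FineSelmerDualDataRelaxedInf κ γ)
    (hpack : ∀ Dr : V.SelmerDualDataRelaxedInf κ γ,
      ∃ (P : Submodule (IwasawaAlgebra 2) (IwasawaAlgebra 2)) (M : Submodule (IwasawaAlgebra 2) P)
        (τ : P →ₛₗ[((IwasawaAlgebra.involEquiv 2).toRingEquiv : IwasawaAlgebra 2 →+* IwasawaAlgebra 2)] Dr.X)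
        (π : Dr.X →ₗ[IwasawaAlgebra 2] Yr.X),
        (∀ m ∈ M, τ m = 0) ∧ Function.Surjective π ∧ Function.Exact τ π ∧
        ∀ G₁ : IwasawaAlgebra 2, iwasawaToPowerSeries 2 G₁ = padicLFunction f (unitRoot V 2 : ℚ_[2]) →
          ∃ s : IwasawaAlgebra 2, s ∉ IwasawaAlgebra.augIdealP 2 ∧
            s * (PowerSeries.C (((2 : ℕ) : ℤ_[2]) ^ (if 0 < V.Δ then 1 else 0)) * G₁) ∈ Submodule.map P.subtype M) :
    ∃ (Xr : Type) (_ : AddCommGroup Xr) (_ : Module (IwasawaAlgebra 2) Xr)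
      (θ : IwasawaAlgebra 2 ≃+* IwasawaAlgebra 2) (P : Submodule (IwasawaAlgebra 2) (IwasawaAlgebra 2))
      (M : Submodule (IwasawaAlgebra 2) P)
      (τ : P →ₛₗ[(θ : IwasawaAlgebra 2 →+* IwasawaAlgebra 2)] Xr) (π : Xr →ₗ[IwasawaAlgebra 2] Yr.X) (e : ℕ),
      (∀ m ∈ M, τ m = 0) ∧ Function.Surjective π ∧ Function.Exact τ π ∧
      Module.lengthAt (IwasawaAlgebra 2) D.X
          ⟨IwasawaAlgebra.augIdealP 2, IwasawaAlgebra.isPrime_augIdealP_holds 2⟩ + e ≤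
        Module.lengthAt (IwasawaAlgebra 2) Xr ⟨IwasawaAlgebra.augIdealP 2, IwasawaAlgebra.isPrime_augIdealP_holds 2⟩ ∧
      ∀ G₁ : IwasawaAlgebra 2, iwasawaToPowerSeries 2 G₁ = padicLFunction f (unitRoot V 2 : ℚ_[2]) →
        ∃ s : IwasawaAlgebra 2, s ∉ IwasawaAlgebra.augIdealP 2 ∧
          s * (PowerSeries.C (((2 : ℕ) : ℤ_[2]) ^ e) * G₁) ∈ Submodule.map P.subtype M := by
  let Dr : V.SelmerDualDataRelaxedInf κ γ := V.selmerDualDataRelaxedInf κ hγ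
  obtain ⟨q, hq⟩ := exists_relaxedSelmerRestrict V κ hγ Dr D
  have hqs := relaxedSelmerRestrict_surjective V κ Dr D q hq
  obtain ⟨P, M, τ, π, hτM, hπs, hπ, himg⟩ := hpack Dr
  refine ⟨Dr.X, inferInstance, inferInstance, (IwasawaAlgebra.involEquiv 2).toRingEquiv, P, M, τ, π,
    (if 0 < V.Δ then 1 else 0), hτM, hπs, hπ, ?_, himg⟩
  by_cases hΔ : 0 < V.Δ
  · obtain ⟨j, hj⟩ := hA V κ γ hκ hord hΔ hγ D Dr q hq
    rw [if_pos hΔ]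
    exact lengthAt_add_one_le_of_archExtension q hqs j hj
  · rw [if_neg hΔ, Nat.cast_zero, add_zero]
    exact Module.lengthAt_le_of_surjective q hqs _

/-- **B7′ `KatoMuPartOff514AtOptimalMemberOfNotSurjectiveTwo` (child stmt-BirchSwinnertonDyer-23921, `:= OrdKatoMuPartOptimalAtTwo`) BY NAME
from R-opt (GENUINE relaxed zeta reading at the optimal member, memo), Aʳ (archimedean `Λ/2`, reserve) and FOUR PRINT facts BY NAME:
Abbes–Ullmo, modularity, Lim 2017 Thm. 3.5 at `2` UPSTAIRS, Ferrero–Washington** — NO half class (compare GEN 4's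
`katoMuPartOff514_of_print_of_colemanHalfClassPackage`, binder Col½-opt = `HasColemanHalfClassPackageAtTwo` at the optimal member).
Assembly: witness = the optimal member `W₀` (p692385, left disjunct); its `μ`-part by §1 with the relaxed data of
`relaxedColemanData_of_package_of_arch` (R-opt's package into the constructed `X^{rel}`, span clause dropped), relaxed (A₂) at `W₀` by
§2 (`W₀` is not onto: `not_hasSurjectiveModNGaloisRep_two_of_isIsogenous`) and `ord₂ ϖ = 0` at `W₀` (Abbes–Ullmo, p692385).
CONDITIONAL; nothing closed. [cite: AbbesUllmo1996, Thm. A] [cite: EdixhovenManin1991, Prop. 2] [cite: Lim2017FineSelmer, §3 Thm. 3.5 and Lemma 3.2]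
[cite: FerreroWashington1979, Theorem] [cite: Kato2004Asterisque, Thm. 16.6 (p. 271), Prop. 17.11 (p. 277), §17.13 (pp. 279–280) (shape; nothing asserted)] -/
theorem katoMuPartOff514_of_print_of_relaxedZetaOptimal_of_arch
    (hAU : abbesUllmo_not_dvd_maninConstant_of_not_dvd_level) (hMod : nonempty_modularParametrizationData)
    (hLim : Lim2017.thm35_at_two_upstairs_fineSelmer_twoTorsion_finite_of_classicalMuVanishes)
    (hFW : ferreroWashington1979_classicalMuVanishes)
    (hR : RelaxedZetaColemanIotaOptimalAtTwo) (hA : ArchimedeanLambdaModTwoOrdAtTwo) :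
    KatoMuPartOff514AtOptimalMemberOfNotSurjectiveTwo := by
  refine katoMuPartOff514_of_optimalMember hAU hMod ?_
  intro W _ _ hcm hgo hns W₀ _ _ N₀ _ D₀ hiso hopt
  haveI : ContinuousSMul ℤ_[2] (W₀.tateModule 2) := TateModule.continuousSMul_padicInt
  haveI : Module.Free ℤ_[2] (W₀.tateModule 2) := W₀.module_free_tateModule_holds 2
  haveI : Module.Finite ℤ_[2] (W₀.tateModule 2) := W₀.module_finite_tateModule_holds 2
  have hgo₀ : GoodOrd W₀ 2 := goodOrd_two_of_isIsogenous W hiso hgo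
  have hns₀ : ¬ W₀.HasSurjectiveModNGaloisRep 2 := not_hasSurjectiveModNGaloisRep_two_of_isIsogenous W hns hiso
  refine Or.inl <| katoMuPartAtTwo_of_relaxedColeman_of_integralRatio W₀ (fun f κ γ hκ hγ hγ' hf D Yr ↦ ?_)
    (fun κ γ hκ hγ Yr ↦
      lengthAt_fineRelaxed_eq_zero_of_not_hasSurjectiveModNGaloisRep_of_limUpstairs_of_FW hLim hFW W₀ hns₀ hκ hγ Yr)
    (fun f hf ϖ hϖ ↦ (padicValRat_two_neronRatio_eq_zero_of_latticeOptimal_of_abbesUllmo hAU W₀ hgo₀.1 D₀ hopt f hf ϖ hϖ).ge)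
  refine relaxedColemanData_of_package_of_arch hA W₀ ⟨hgo₀.1, hgo₀.2⟩ f hκ hγ D Yr fun Dr ↦ ?_
  obtain ⟨I, Z, P, ℓ, τ, π, -, hτℓ, hπs, hπ, himg⟩ :=
    hR W hcm hgo hns W₀ D₀ hiso hopt f κ γ hκ hγ hγ' hf Dr Yr
  refine ⟨P, Submodule.map ℓ Z, τ, π, ?_, hπs, hπ, fun G₁ hG₁ ↦ ?_⟩
  · rintro _ ⟨z, hz, rfl⟩
    exact hτℓ z hz
  · obtain ⟨s, hs, hsG⟩ := himg G₁ hG₁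
    exact ⟨s, hs, by rw [← Submodule.map_comp]; exact hsG⟩

/-- **The route's child `OrdKatoMuPartOptimalAtTwo` (stmt-BirchSwinnertonDyer-23921, text = B7′ verbatim) BY NAME from R-opt, Aʳ and the
four print facts** — the relaxed road's supplier of skeleton v15's stub Col½-opt, WITHOUT a half class. CONDITIONAL; the item is NOT
closed by this; nothing asserted. [cite: AbbesUllmo1996, Thm. A] [cite: Lim2017FineSelmer, §3 Thm. 3.5] [cite: FerreroWashington1979, Theorem] -/
theorem ordKatoMuPartOptimalAtTwo_of_print_of_relaxedZetaOptimal_of_arch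
    (hAU : abbesUllmo_not_dvd_maninConstant_of_not_dvd_level) (hMod : nonempty_modularParametrizationData)
    (hLim : Lim2017.thm35_at_two_upstairs_fineSelmer_twoTorsion_finite_of_classicalMuVanishes)
    (hFW : ferreroWashington1979_classicalMuVanishes)
    (hR : RelaxedZetaColemanIotaOptimalAtTwo) (hA : ArchimedeanLambdaModTwoOrdAtTwo) :
    OrdKatoMuPartOptimalAtTwo :=
  katoMuPartOff514_of_print_of_relaxedZetaOptimal_of_arch hAU hMod hLim hFW hR hA

/-! ## §5 The crux BY NAME in the fully relaxed currency -/

/-- **The crux `OrdKatoHalfAtTwoIso` (stmt-BirchSwinnertonDyer-19573) BY NAME with every `0 < Δ` Coleman input in the RELAXED-GENUINE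
currency**: F1μι⁻ (`Δ < 0`, onto; memo), R⁺ (`0 < Δ`, onto; memo), R-opt (not onto, at the lattice-optimal member; memo) — all three
«Kato's GENUINE zeta classes in ι-keyed Coleman coordinates», on strict resp. relaxed-at-`∞` carriers, NO half class anywhere — plus Aʳ
(the archimedean `Λ/2`, reserve [ASP] 6.9 (i)), Iw⁺ (Iwasawa's `μ₂ = 0` for `ℚ(W[2], √−1)` on the onto-`0 < Δ` cell, OPEN) and PRINT
{the bundle (child 23889: PUB ∧ Abbes–Ullmo ∧ Greenberg 5.14@2), modularity, Lim 2017 Thm 3.5 at `2` upstairs, Ferrero–Washington}.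
Lead g5's split glue `ordKatoHalfAtTwoIso_of_iota_halves`. Compare the (ε) composition
`ordKatoHalfAtTwoIso_of_negDisc_of_colemanMu_of_lim_of_classicalMu` (P⁺ and B7′'s Col½-opt = HALF-class packages). CONDITIONAL on the
displayed OPEN statements; the crux is NOT closed by this. [cite: Kato2004Asterisque, Thm. 12.6, 16.6, 17.4, Prop. 17.11, §17.13 (shape)]
[cite: Lim2017FineSelmer, §3 Thm. 3.5] [cite: FerreroWashington1979, Theorem] [cite: AbbesUllmo1996, Thm. A] -/
theorem ordKatoHalfAtTwoIso_of_negDisc_of_relaxedZeta_of_arch_of_lim_upstairs (hNeg : ZetaColemanMuIotaNegDiscAtTwo)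
    (hR : RelaxedZetaColemanIotaPosDiscAtTwo) (hRopt : RelaxedZetaColemanIotaOptimalAtTwo) (hA : ArchimedeanLambdaModTwoOrdAtTwo)
    (hIw : ClassicalMuTwoDivisionFieldAdjoinIOrdPosDisc)
    (hLim : Lim2017.thm35_at_two_upstairs_fineSelmer_twoTorsion_finite_of_classicalMuVanishes)
    (hFW : ferreroWashington1979_classicalMuVanishes) (hMod : nonempty_modularParametrizationData)
    (hbundle : OrdPublishedInputsAtTwo ∧ abbesUllmo_not_dvd_maninConstant_of_not_dvd_level ∧
      Greenberg1999.prop514_isTorsion_mu_eq_zero_two) : OrdKatoHalfAtTwoIso := by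
  have hAU : abbesUllmo_not_dvd_maninConstant_of_not_dvd_level := hbundle.2.1
  obtain ⟨_, _, h17, _⟩ := hbundle.1
  exact ordKatoHalfAtTwoIso_of_iota_halves hNeg
    (ordKatoHalfAtTwoIsoPosDisc_of_relaxedZeta_of_arch_of_lim_upstairs_of_classicalMu hR hA hLim hIw hAU h17) hbundle
    (katoMuPartOff514_of_print_of_relaxedZetaOptimal_of_arch hAU hMod hLim hFW hRopt hA)

end Summit.BirchSwinnertonDyer.BirchSwinnertonDyer.Theorems.SteinbergFibreAtTwo

end
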